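import Summits.CriticalPhenomena.SAWScalingLimit.Theses.SAWRenewalTightness
import Summits.CriticalPhenomena.SAWScalingLimit.Theorems.SAWRenewalTightnessShellCrossingBoundSplit
import Summits.CriticalPhenomena.SAWScalingLimit.Theorems.SAWRenewalTightnessTightOfShellCrossing
import Summits.CriticalPhenomena.SAWScalingLimit.Theorems.SAWRenewalTightnessEventualTightSketchDefs

/-!
# Line `virgin-count` — alternative skeleton for the crux `SAWRenewalTightness.EventualTight`
# (stmt-CriticalPhenomena-1372; crux-strategist s1, 2026-08-17; registered `--alt`, the live line `Sketch` v5 is untouched)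

Crux (FIXED, concluded BY NAME by `EventualTight_of`): for every Dobrushin domain `D` and endpoint
approximation `(a_δ, b_δ)` there is `δ₀ > 0` such that the pushed-forward critical SAW laws
`(SAW.law D δ a_δ b_δ).map curve`, `δ ∈ (0, δ₀]`, form a tight set of measures on `CurveClass ℂ`.

## Why another line (what it does that `Sketch` v5 does not)

`Sketch` v5 (lead c3/c4) has two open stubs, both research-open: S3″ `stub_bulkCleanMultiShadowDecay` (the bulk
multi-strand atom in clean co-oriented SHADOW normal form, a DOMAIN-level statement: Dobrushin domain, endpoint
approximation, mesh `δ → 0`) and E `stub_confinementPositivity`.  The stall recorded by the harness ("no named stub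
landed in 6 h") is structural: neither open stub of v5 has a tool, and the only provable work in sight — the exact
two-sided domain-Markov VIRGINIZATION that every analysis of this crux names as the surviving architecture
(`LeadAnalysis-c1` §2(c), `-c2` §5, `-c3` §2, `MERGE-c3` §3/§5) — is not a registered stub of any line of THIS item
(it is registered, in the costlier clean-shadow form, on the twins' `birth` skeletons, stmt-1881/4922).  This line
registers the consensus end-state architecture for stmt-1372 in its cheapest typing, with TWO provable stubs:

* E `stub_confinementPositivity` — restriction positivity, VERBATIM the audited statement (= child
  `ConfinementPositivity`, stmt-17587, of the strategist's split; shared with `Sketch` v5 and stmt-4728's line).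
* X `stub_virginArcTravTightOneShape` (named apart from the lead's `stub_virginArcTraversalTight` of `Sketch` v6, which is the
  two-aspect vertex-traversal form of the same atom) — **the bulk atom in its final form**: PURE LATTICE (no domain, no mesh, no
  endpoint approximation), COUNT form (Aizenman–Burchard separate traversals, no shadowing clauses), ONE SHAPE
  (shell `D(z₀; N/3, 2N/3)` inside a virgin lattice disc of radius `N`), uniform over arbitrary exteriors and door
  pairs: for every `ε > 0` there are `k, N₀` such that for every configuration `(H, Λ)` virgin in `B(z₀, N)`,
  `N ≥ N₀`, and every pair of doors `(u, c), (u′, c′)`, the `x_c`-mass of self-avoiding `H`-arcs `c → c′` in `Λ`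
  whose lattice polyline makes `k` separate traversals of `D(z₀; N/3, 2N/3)` is `≤ ε ·` (arc mass).  NOT implied by
  the crux (sup over exteriors) — it can be attacked by the disprover and by numerics at fixed `N`; it is MERGE-c3's
  X2c at the single aspect the composition needs.
* V `stub_virginizationCount` — **exact glue, provable (L)**: X → `BulkShellTightAtAspectTwo` (per-shell count
  tightness on interior shells `D(y; η, 2η)` with `B̄(y, 4η) ⊆ Ω`).  First-entrance / last-exit cut of the SAW at
  the closed lattice disc `B̄(y/δ, 3η/δ)`; conditionally on prefix and suffix the middle piece is `x_c`-distributed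
  on the arcs of `(discreteDomainGraph Ω δ, meshDomain ∖ (prefix ∪ suffix))`, which is virgin at `(y/δ, 3η/δ)` for
  `δ ≤ η` small (closed `(N+1)`-disc = Euclidean `3η + δ ≤ 4η` inside `Ω`; its lattice points form one
  `meshGraph`-component, so all-in or none-in `meshDomain`; endpoints eventually outside by the endpoint limits,
  `a, b ∈ ∂Ω` at distance `> 4η` from `y`); the event is transported in COUNT form (a traversal of `D(y; η, 2η)`
  by the scaled polyline is a traversal of `D(y/δ; N/3, 2N/3)` by the lattice polyline of the middle piece:
  similarity `z ↦ z/δ`, and the traversal segments avoid prefix/suffix edges, which stay outside the closed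
  `(N−1)`-disc) — the hex template `HexSAWVirginizationCut/Chordal.sum_vertexTraversals_le_chordal` verbatim,
  WITHOUT the ≈ 350-line reparametrisation bookkeeping the clean-shadow form would need (MERGE-c3 §5).  Generic
  pieces in tree: `SAWEdgeListSurgery.split_first_last_iff`, `SAWRestrictionCovariance`
  (`law_apply_eq_inv_mul_weight`), `exists_domainSAW_of_meshDomain_subset`, `PolylineShellTraversals`.
* A `stub_aspectReduction` — **provable now (M)**: `BulkShellTightAtAspectTwo → BulkShellTight` (all aspects, collar
  `2R`; = child `BulkShellTight`, stmt-17588).  Wide shells `R ≥ 2η`: sub-shell monotonicity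
  `Curve.HasTraversals.mono'` (`D(y; η, 2η) ⊆ D(y; η, R)`, collar `4η ≤ 2R`).  Thin shells `η < R < 2η`: middle
  circle `m = (η+R)/2`, net of `M` points (`Theorems.exists_netPoint_hasTraversals`, landed p138355: `M·J+1`
  traversals ⇒ `J+1` traversals of `D(yᵢ; 2πm/M, R′)` for some net point, `R′ = (R−η)/2`), `M ≥ 4πm/R′` so that
  the small shell has aspect `≥ 2`, then the wide case at `yᵢ` (collar `B̄(yᵢ, 8πm/M) ⊆ B̄(y, 2R)`), union bound
  `measure_iUnion_fintype_le` with `ε/M` per net point.  This is the remark that ONE aspect ratio carries the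
  whole atom (AB99 §1.b), made into a registered rung so that X can be stated for one shape.

Composition (kernel-checked, no `sorry` outside the stubs):
`EventualTight_of hE hX hV hA := TightOfShellCrossing_proof (ShellCrossingBound_of_subs hE (hA (hV hX)))`
(landed p138355 and stmt-4732).  Through the strategist's split (route file rev 2) the same four stubs close the
children: `hA (hV hX) : BulkShellTight` (stmt-17588) and `hE : ConfinementPositivity` (stmt-17587).

## Calibration (standing `Cruxes/EventualTight/Disproof.lean`, cdisprove gen 1; `Theorems/EventualTight/Negative/*`)

* §2 `eventualTight_false_without_endpointLimits`: HONOURED — the endpoint limits are spent in V (endpoints leave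
  the virgin disc) and inside the landed `ShellCrossingBound_of_subs` (nesting of the socketed enlargement).
* §5 `eventualTight_false_without_jordan` (dyadic snake forces unboundedly many traversals of ONE boundary shell):
  HONOURED — the Jordan loop is consumed once, in `Theorems.stub_socketedEnlargement` (p97679) inside the landed
  glue; X, V, A concern interior shells only, where nothing is forced; E carries the boundary.
* §3 `not_cruxAllMeshes` (stmt-0772) / `not_uniformThreshold` / `not_uniformDomains`: every threshold (`k, N₀`;
  `j, δ₁`; `c, δ₀`) sits under its `∀`; all mesh quantifiers are eventual.  No landed `Negative/*` lemma has an
  instance among the stubs (X is exterior-uniform but scale-thresholded `N ≥ N₀(ε)`, so the fixed-mesh forcing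
  witnesses do not instantiate it: a forcing exterior acts only through the two doors and the outside, and inside
  the virgin disc no traversal is forced).  Negatives index: only stmt-0772; avoided.

Namespace `…Cruxes.EventualTight.VirginCount`.  Every stub is stated over TREE VOCABULARY ONLY (Mathlib +
`Literature.*` + the route decl), the local `def`s being unfolded by hand, so that each lands verbatim as
`Theorems/SAWRenewalTightnessEventualTight<Stub>.lean --supports stmt-CriticalPhenomena-1372`; `*_iff` lemmas certify
the unfoldings definitionally.
-/

noncomputable section

open MeasureTheory Filter Topology Set Metric
open scoped ENNReal NNReal unitInterval Real
open Literature.Probability.RandomPlanarGeometry Literature.Probability.LatticeModels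
open Summit.CriticalPhenomena.SAWScalingLimit.Theses.SAWRenewalTightness (EventualTight ShellCrossingBound)
open Summit.CriticalPhenomena.SAWScalingLimit.Theorems (TightOfShellCrossing_proof ShellCrossingBound_of_subs)

namespace Summit.CriticalPhenomena.SAWScalingLimit.Cruxes.EventualTight.VirginCount

/-! ### Vocabulary (lattice units; the objects of `X2VirginDiscZ2.lean`, inlined) -/

/-- **Virgin configuration** at `(z₀, N)`: `H ≤ ℤ²`, every lattice point of the open `N`-disc is allowed, every
lattice edge of the closed `(N+1)`-disc is an `H`-edge; nothing is assumed outside. -/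
def IsVirgin (H : SimpleGraph (Site 2)) (Λ : Finset (Site 2)) (z₀ : ℂ) (N : ℝ) : Prop :=
  H ≤ zdGraph 2 ∧ (∀ v : Site 2, dist (Site.toComplex v) z₀ < N → v ∈ Λ) ∧
    ∀ v v' : Site 2, dist (Site.toComplex v) z₀ ≤ N + 1 → dist (Site.toComplex v') z₀ ≤ N + 1 →
      (zdGraph 2).Adj v v' → H.Adj v v'

/-- **Door** on the circle of radius `N`: a lattice edge from `u ∉ Λ` strictly outside to `c ∈ Λ` inside. -/
def IsDoor (Λ : Finset (Site 2)) (z₀ : ℂ) (N : ℝ) (u c : Site 2) : Prop :=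
  (zdGraph 2).Adj u c ∧ u ∉ Λ ∧ c ∈ Λ ∧ dist (Site.toComplex c) z₀ ≤ N ∧ N < dist (Site.toComplex u) z₀

/-- **Arcs**: self-avoiding `H`-walks `c → c'` with all vertices allowed. -/
def Arc (H : SimpleGraph (Site 2)) (Λ : Finset (Site 2)) (c c' : Site 2) : Type :=
  {p : H.Walk c c' // p.IsPath ∧ ∀ v ∈ p.support, v ∈ Λ}

/-- `x_c`-mass of the arcs. -/
def arcMass (H : SimpleGraph (Site 2)) (Λ : Finset (Site 2)) (c c' : Site 2) : ℝ :=
  ∑' p : Arc H Λ c c', SAW.criticalFugacity ^ p.1.length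

/-- `x_c`-mass of the arcs whose lattice polyline makes `k` separate traversals of `D(z₀; n, R)`. -/
def travMass (H : SimpleGraph (Site 2)) (Λ : Finset (Site 2)) (c c' : Site 2) (k : ℕ) (z₀ : ℂ) (n R : ℝ) : ℝ :=
  ∑' p : Arc H Λ c c',
    {q : Arc H Λ c c' | (⟨q.1.toCurve Site.toComplex⟩ : Curve ℂ).HasTraversals k z₀ n R}.indicator
      (fun q => SAW.criticalFugacity ^ q.1.length) p

/-! ### The four statements of the line -/

/-- **X `VirginArcTraversalTight`** — the bulk atom, pure lattice, count form, one shape. -/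
def VirginArcTraversalTight : Prop :=
  ∀ ε : ℝ, 0 < ε → ∃ (k : ℕ) (N₀ : ℝ), 0 < N₀ ∧
    ∀ (H : SimpleGraph (Site 2)) (Λ : Finset (Site 2)) (z₀ : ℂ) (N : ℝ) (u c u' c' : Site 2),
      N₀ ≤ N → IsVirgin H Λ z₀ N → IsDoor Λ z₀ N u c → IsDoor Λ z₀ N u' c' →
      travMass H Λ c c' k z₀ (N / 3) (2 * N / 3) ≤ ε * arcMass H Λ c c'

/-- **`BulkShellTightAtAspectTwo`** — per-shell count tightness on interior shells of aspect two, collar `4η`. -/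
def BulkShellTightAtAspectTwo : Prop :=
  ∀ (D : DobrushinDomain) (a b : ℝ → Site 2), SAW.IsEndpointApprox D a b →
    ∀ (y : ℂ) (η : ℝ), 0 < η → Metric.closedBall y (4 * η) ⊆ D.carrier →
      ∀ ε : ℝ, 0 < ε → ∃ (j : ℕ) (δ₁ : ℝ), 0 < δ₁ ∧ ∀ δ ∈ Set.Ioc (0 : ℝ) δ₁,
        SAW.law D.carrier δ (a δ) (b δ)
          {γ | (⟨γ.walk.toCurve (meshPoint δ)⟩ : Curve ℂ).HasTraversals j y η (2 * η)} ≤ ENNReal.ofReal ε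

/-- **`BulkShellTight`** — verbatim the child stmt-17588 / hypothesis 2 of `Theorems.ShellCrossingBound_of_subs`. -/
def BulkShellTight : Prop :=
  ∀ (D : DobrushinDomain) (a b : ℝ → Site 2), SAW.IsEndpointApprox D a b →
    ∀ (y : ℂ) (η R : ℝ), 0 < η → η < R → Metric.closedBall y (2 * R) ⊆ D.carrier →
      ∀ ε : ℝ, 0 < ε → ∃ (j : ℕ) (δ₁ : ℝ), 0 < δ₁ ∧ ∀ δ ∈ Set.Ioc (0 : ℝ) δ₁,
        SAW.law D.carrier δ (a δ) (b δ)
          {γ | (⟨γ.walk.toCurve (meshPoint δ)⟩ : Curve ℂ).HasTraversals j y η R} ≤ ENNReal.ofReal ε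

/-- **`ConfinementPositivity`** — verbatim the child stmt-17587 / the audited stub. -/
def ConfinementPositivity : Prop :=
  ∀ (D D' : DobrushinDomain) (a b : ℝ → Site 2) (d : ℝ), 0 < d →
    D'.carrier ⊆ D.carrier → D'.pt 0 = D.pt 0 → D'.pt 1 = D.pt 1 →
    D.carrier ∩ (Metric.ball (D.pt 0) d ∪ Metric.ball (D.pt 1) d) ⊆ D'.carrier →
    SAW.IsEndpointApprox D' a b →
      ∃ c δ₀ : ℝ, 0 < c ∧ 0 < δ₀ ∧ ∀ δ ∈ Set.Ioc (0 : ℝ) δ₀,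
        ENNReal.ofReal c ≤ SAW.law D.carrier δ (a δ) (b δ)
          {γ | ∃ γ' : SAW.DomainSAW D'.carrier δ (a δ) (b δ), γ'.walk.support = γ.walk.support}

/-! ### The stubs (the ONLY `sorry`s of the file), over tree vocabulary -/

/-- **E `stub_confinementPositivity`** (research-open; summit-implied, p105757; = stmt-17587). -/
theorem stub_confinementPositivity :
    ∀ (D D' : DobrushinDomain) (a b : ℝ → Site 2) (d : ℝ), 0 < d →
      D'.carrier ⊆ D.carrier → D'.pt 0 = D.pt 0 → D'.pt 1 = D.pt 1 →
      D.carrier ∩ (Metric.ball (D.pt 0) d ∪ Metric.ball (D.pt 1) d) ⊆ D'.carrier →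
      SAW.IsEndpointApprox D' a b →
        ∃ c δ₀ : ℝ, 0 < c ∧ 0 < δ₀ ∧ ∀ δ ∈ Set.Ioc (0 : ℝ) δ₀,
          ENNReal.ofReal c ≤ SAW.law D.carrier δ (a δ) (b δ)
            {γ | ∃ γ' : SAW.DomainSAW D'.carrier δ (a δ) (b δ), γ'.walk.support = γ.walk.support} := by
  sorry

/-- **X `stub_virginArcTravTightOneShape`** (the atom; research-open; NOT crux-implied). -/
theorem stub_virginArcTravTightOneShape :
    ∀ ε : ℝ, 0 < ε → ∃ (k : ℕ) (N₀ : ℝ), 0 < N₀ ∧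
      ∀ (H : SimpleGraph (Site 2)) (Λ : Finset (Site 2)) (z₀ : ℂ) (N : ℝ) (u c u' c' : Site 2),
        N₀ ≤ N →
        (H ≤ zdGraph 2 ∧ (∀ v : Site 2, dist (Site.toComplex v) z₀ < N → v ∈ Λ) ∧
          ∀ v v' : Site 2, dist (Site.toComplex v) z₀ ≤ N + 1 → dist (Site.toComplex v') z₀ ≤ N + 1 →
            (zdGraph 2).Adj v v' → H.Adj v v') →
        ((zdGraph 2).Adj u c ∧ u ∉ Λ ∧ c ∈ Λ ∧ dist (Site.toComplex c) z₀ ≤ N ∧ N < dist (Site.toComplex u) z₀) →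
        ((zdGraph 2).Adj u' c' ∧ u' ∉ Λ ∧ c' ∈ Λ ∧ dist (Site.toComplex c') z₀ ≤ N ∧
          N < dist (Site.toComplex u') z₀) →
        (∑' p : {p : H.Walk c c' // p.IsPath ∧ ∀ v ∈ p.support, v ∈ Λ},
            {q : {p : H.Walk c c' // p.IsPath ∧ ∀ v ∈ p.support, v ∈ Λ} |
                (⟨q.1.toCurve Site.toComplex⟩ : Curve ℂ).HasTraversals k z₀ (N / 3) (2 * N / 3)}.indicator
              (fun q => SAW.criticalFugacity ^ q.1.length) p)
          ≤ ε * ∑' p : {p : H.Walk c c' // p.IsPath ∧ ∀ v ∈ p.support, v ∈ Λ},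
              SAW.criticalFugacity ^ p.1.length := by
  sorry

/-- **V `stub_virginizationCount`** (exact two-sided domain-Markov glue; provable, L). -/
theorem stub_virginizationCount :
    (∀ ε : ℝ, 0 < ε → ∃ (k : ℕ) (N₀ : ℝ), 0 < N₀ ∧
      ∀ (H : SimpleGraph (Site 2)) (Λ : Finset (Site 2)) (z₀ : ℂ) (N : ℝ) (u c u' c' : Site 2),
        N₀ ≤ N →
        (H ≤ zdGraph 2 ∧ (∀ v : Site 2, dist (Site.toComplex v) z₀ < N → v ∈ Λ) ∧
          ∀ v v' : Site 2, dist (Site.toComplex v) z₀ ≤ N + 1 → dist (Site.toComplex v') z₀ ≤ N + 1 →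
            (zdGraph 2).Adj v v' → H.Adj v v') →
        ((zdGraph 2).Adj u c ∧ u ∉ Λ ∧ c ∈ Λ ∧ dist (Site.toComplex c) z₀ ≤ N ∧ N < dist (Site.toComplex u) z₀) →
        ((zdGraph 2).Adj u' c' ∧ u' ∉ Λ ∧ c' ∈ Λ ∧ dist (Site.toComplex c') z₀ ≤ N ∧
          N < dist (Site.toComplex u') z₀) →
        (∑' p : {p : H.Walk c c' // p.IsPath ∧ ∀ v ∈ p.support, v ∈ Λ},
            {q : {p : H.Walk c c' // p.IsPath ∧ ∀ v ∈ p.support, v ∈ Λ} |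
                (⟨q.1.toCurve Site.toComplex⟩ : Curve ℂ).HasTraversals k z₀ (N / 3) (2 * N / 3)}.indicator
              (fun q => SAW.criticalFugacity ^ q.1.length) p)
          ≤ ε * ∑' p : {p : H.Walk c c' // p.IsPath ∧ ∀ v ∈ p.support, v ∈ Λ},
              SAW.criticalFugacity ^ p.1.length) →
    ∀ (D : DobrushinDomain) (a b : ℝ → Site 2), SAW.IsEndpointApprox D a b →
      ∀ (y : ℂ) (η : ℝ), 0 < η → Metric.closedBall y (4 * η) ⊆ D.carrier →
        ∀ ε : ℝ, 0 < ε → ∃ (j : ℕ) (δ₁ : ℝ), 0 < δ₁ ∧ ∀ δ ∈ Set.Ioc (0 : ℝ) δ₁,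
          SAW.law D.carrier δ (a δ) (b δ)
            {γ | (⟨γ.walk.toCurve (meshPoint δ)⟩ : Curve ℂ).HasTraversals j y η (2 * η)} ≤ ENNReal.ofReal ε := by
  sorry

/-- **A `stub_aspectReduction`** (one aspect ratio carries the atom; provable now, M). -/
theorem stub_aspectReduction :
    (∀ (D : DobrushinDomain) (a b : ℝ → Site 2), SAW.IsEndpointApprox D a b →
      ∀ (y : ℂ) (η : ℝ), 0 < η → Metric.closedBall y (4 * η) ⊆ D.carrier →
        ∀ ε : ℝ, 0 < ε → ∃ (j : ℕ) (δ₁ : ℝ), 0 < δ₁ ∧ ∀ δ ∈ Set.Ioc (0 : ℝ) δ₁,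
          SAW.law D.carrier δ (a δ) (b δ)
            {γ | (⟨γ.walk.toCurve (meshPoint δ)⟩ : Curve ℂ).HasTraversals j y η (2 * η)} ≤ ENNReal.ofReal ε) →
    ∀ (D : DobrushinDomain) (a b : ℝ → Site 2), SAW.IsEndpointApprox D a b →
      ∀ (y : ℂ) (η R : ℝ), 0 < η → η < R → Metric.closedBall y (2 * R) ⊆ D.carrier →
        ∀ ε : ℝ, 0 < ε → ∃ (j : ℕ) (δ₁ : ℝ), 0 < δ₁ ∧ ∀ δ ∈ Set.Ioc (0 : ℝ) δ₁,
          SAW.law D.carrier δ (a δ) (b δ)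
            {γ | (⟨γ.walk.toCurve (meshPoint δ)⟩ : Curve ℂ).HasTraversals j y η R} ≤ ENNReal.ofReal ε := by
  sorry

/-! ### Definitional certificates: each stub IS its named statement -/

theorem virginArcTraversalTight_iff :
    VirginArcTraversalTight ↔
    (∀ ε : ℝ, 0 < ε → ∃ (k : ℕ) (N₀ : ℝ), 0 < N₀ ∧
      ∀ (H : SimpleGraph (Site 2)) (Λ : Finset (Site 2)) (z₀ : ℂ) (N : ℝ) (u c u' c' : Site 2),
        N₀ ≤ N →
        (H ≤ zdGraph 2 ∧ (∀ v : Site 2, dist (Site.toComplex v) z₀ < N → v ∈ Λ) ∧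
          ∀ v v' : Site 2, dist (Site.toComplex v) z₀ ≤ N + 1 → dist (Site.toComplex v') z₀ ≤ N + 1 →
            (zdGraph 2).Adj v v' → H.Adj v v') →
        ((zdGraph 2).Adj u c ∧ u ∉ Λ ∧ c ∈ Λ ∧ dist (Site.toComplex c) z₀ ≤ N ∧ N < dist (Site.toComplex u) z₀) →
        ((zdGraph 2).Adj u' c' ∧ u' ∉ Λ ∧ c' ∈ Λ ∧ dist (Site.toComplex c') z₀ ≤ N ∧
          N < dist (Site.toComplex u') z₀) →
        (∑' p : {p : H.Walk c c' // p.IsPath ∧ ∀ v ∈ p.support, v ∈ Λ},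
            {q : {p : H.Walk c c' // p.IsPath ∧ ∀ v ∈ p.support, v ∈ Λ} |
                (⟨q.1.toCurve Site.toComplex⟩ : Curve ℂ).HasTraversals k z₀ (N / 3) (2 * N / 3)}.indicator
              (fun q => SAW.criticalFugacity ^ q.1.length) p)
          ≤ ε * ∑' p : {p : H.Walk c c' // p.IsPath ∧ ∀ v ∈ p.support, v ∈ Λ},
              SAW.criticalFugacity ^ p.1.length) :=
  Iff.rfl

theorem virginArcTraversalTight_holds : VirginArcTraversalTight :=
  virginArcTraversalTight_iff.2 stub_virginArcTravTightOneShape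

theorem confinementPositivity_holds : ConfinementPositivity := stub_confinementPositivity

theorem bulkShellTightAtAspectTwo_of (hX : VirginArcTraversalTight) : BulkShellTightAtAspectTwo :=
  stub_virginizationCount (virginArcTraversalTight_iff.1 hX)

theorem bulkShellTight_of (h : BulkShellTightAtAspectTwo) : BulkShellTight := stub_aspectReduction h

/-! ### Composition (no `sorry` of its own): the crux BY NAME, and the two split children -/

/- The split children (route file rev 2, stmt-17587/17588) follow from the same stubs: `hA (hV hX)` has the
type of `SAWRenewalTightness.BulkShellTight` and `hE` that of `SAWRenewalTightness.ConfinementPositivity`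
(syntactically identical bodies; stated against the local copies `BulkShellTight` / `ConfinementPositivity` here so
that this file does not depend on the route-file revision). -/
theorem child_bulkShellTight (hX : VirginArcTraversalTight)
    (hV : VirginArcTraversalTight → BulkShellTightAtAspectTwo) (hA : BulkShellTightAtAspectTwo → BulkShellTight) :
    BulkShellTight :=
  hA (hV hX)

/-- **`EventualTight` from the line `virgin-count`**: restriction positivity (E), the virgin-arc count atom (X),
exact virginization (V) and the aspect reduction (A) give the crux, through the landed split glue
`ShellCrossingBound_of_subs` (p138355) and the landed Aizenman–Burchard criterion `TightOfShellCrossing_proof`. -/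
theorem EventualTight_of (hE : ConfinementPositivity) (hX : VirginArcTraversalTight)
    (hV : VirginArcTraversalTight → BulkShellTightAtAspectTwo) (hA : BulkShellTightAtAspectTwo → BulkShellTight) :
    EventualTight :=
  TightOfShellCrossing_proof (ShellCrossingBound_of_subs hE (hA (hV hX)))

/-- The crux as stated (all four stubs discharged by name; becomes the crux proof when the `sorry`s close). -/
theorem EventualTight_proof : EventualTight :=
  EventualTight_of stub_confinementPositivity virginArcTraversalTight_holds
    (fun hX => stub_virginizationCount (virginArcTraversalTight_iff.1 hX)) stub_aspectReduction

end Summit.CriticalPhenomena.SAWScalingLimit.Cruxes.EventualTight.VirginCount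

end
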